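import Summits.Parity.GeneralizedHardyLittlewood.Theorems.PsiGradedTablesClosePoly.Negative.WrapBoundNoClosing
import HarnessLib

/-!
# The exact two-constant wrap threshold ON a class: `c₂ ≤ 1 − 2c₁²`

Supports `Summit.Parity.GeneralizedHardyLittlewood.Theses.ZDegreeToeplitzBand.PsiGradedTablesClosePoly` (stmt-Parity-22438) on the
NEGATIVE lane: pure (A)-free algebra on the graded main-term matrix; no Theses statement asserted, no new `Prop`, standard axioms.

`WrapBoundNoClosing.not_gradedClosesOn_of_cells_le_half_geom` (ls-ref-1, p592244) kills closing on a class from ONE uniform constant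
`c ≤ ½` on all three tables. A displayed wrap estimate will not carry the same constant on the degree-1 long tables `x₁, y₁` and on the
degree-2 table `x₂`: with `‖X₁(u,v)‖², ‖Y₁(u,v)‖² ≤ c₁²·𝔅(u)𝔅(v)` and `‖X₂(u,v)‖² ≤ c₂²·𝔅(u)𝔅(v)` the worst-phase normalised
matrix `[[1,−c₁,−c₂],[−c₁,1,−c₁],[−c₂,−c₁,1]]` has determinant `(1 − 2c₁² − c₂)(1 + c₂)`, so:

* `not_gradedClosesOn_of_cells_le_mixed` — **BELOW the parabola `c₂ ≤ 1 − 2c₁²` there is no closing on the class** (SOS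
  `(a₁ − c₁(a₀+a₂))² + (1−c₁²)(a₀−a₂)² + 2(1−2c₁²−c₂)a₀a₂`); the points `(½,½)` (p592244), `(0,0)` (`not_gradedClosesOn_of_darkOn`)
  and the 2×2-minor vertex `(0,1)` lie on or under it;
* `mixedTriple_gradedQuadForm` / `gradedClosesOn_mixedTriple` — **ABOVE it the aligned real design closes** at the explicit amplitudes
  `(1, 2c₁, 1)` (form `= 2B(1 − 2c₁² − c₂)`), so the curve is sharp along its whole length (at `c₁ = c₂` it is the coherent triple of
  `DetClosesOn`, threshold `½`).

Reading for the wrap display of the registered line `long_poly_dil`: FAIL BY NAME iff the displayed constants satisfy `c₂ ≤ 1 − 2c₁²`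
uniformly on the class; above the parabola at ATTAINED constants the det / coherent certificates fire.
-/

noncomputable section

open Complex Real ComplexConjugate Matrix

namespace Summit.Parity.GeneralizedHardyLittlewood.Theorems.PsiGradedTablesClosePoly.Negative

open Literature.NumberTheory.LFunctions.Zhang2022 Literature.NumberTheory.LFunctions.Zhang2022.KnifeEdge
open Literature.NumberTheory.LFunctions.Zhang2022.Repair

/-! ### Part 1 — the real core and the scaled cross-term bound (pure algebra) -/

/-- The real quadratic `a₀² + a₁² + a₂² − 2c₁a₀a₁ − 2c₁a₁a₂ − 2c₂a₀a₂` is non-negative for `a₀, a₂ ≥ 0` when `0 ≤ c₂ ≤ 1 − 2c₁²`: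
it equals `(a₁ − c₁(a₀+a₂))² + (1−c₁²)(a₀−a₂)² + 2(1−2c₁²−c₂)a₀a₂`. [folklore] -/
theorem mixed_real_form_nonneg {c₁ c₂ a₀ a₁ a₂ : ℝ} (hc₂ : 0 ≤ c₂) (hmix : c₂ ≤ 1 - 2 * c₁ ^ 2)
    (ha₀ : 0 ≤ a₀) (ha₂ : 0 ≤ a₂) :
    0 ≤ a₀ ^ 2 + a₁ ^ 2 + a₂ ^ 2 - 2 * c₁ * a₀ * a₁ - 2 * c₁ * a₁ * a₂ - 2 * c₂ * a₀ * a₂ := by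
  have hc₁sq : c₁ ^ 2 ≤ 1 := by nlinarith [sq_nonneg c₁]
  nlinarith [sq_nonneg (a₁ - c₁ * (a₀ + a₂)), mul_nonneg (sub_nonneg.mpr hc₁sq) (sq_nonneg (a₀ - a₂)),
    mul_nonneg (mul_nonneg (show (0:ℝ) ≤ 1 - 2 * c₁ ^ 2 - c₂ by linarith) ha₀) ha₂]

/-- Cross term against a constant: `‖u‖² ≤ c²·B_z·B_w` (`c, B_z, B_w ≥ 0`) ⇒
`−2c·(√B_z‖z‖)(√B_w‖w‖) ≤ 2Re(z·conj(w·u))`. [folklore] -/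
theorem two_re_cross_ge_const (z w u : ℂ) {Bz Bw c : ℝ} (hBz : 0 ≤ Bz) (hBw : 0 ≤ Bw) (hc : 0 ≤ c)
    (hu : ‖u‖ ^ 2 ≤ c ^ 2 * (Bz * Bw)) :
    -(2 * c * (Real.sqrt Bz * ‖z‖) * (Real.sqrt Bw * ‖w‖)) ≤ 2 * (z * conj (w * u)).re := by
  have h1 : |(z * conj (w * u)).re| ≤ ‖z * conj (w * u)‖ := Complex.abs_re_le_norm _
  have h2 : ‖z * conj (w * u)‖ = ‖z‖ * (‖w‖ * ‖u‖) := by simp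
  have h3 := (abs_le.mp h1).1
  rw [h2] at h3
  -- ‖u‖ ≤ c·√Bz·√Bw from the squared hypothesis
  have hsq : ‖u‖ ^ 2 ≤ (c * (Real.sqrt Bz * Real.sqrt Bw)) ^ 2 := by
    rw [mul_pow, mul_pow, Real.sq_sqrt hBz, Real.sq_sqrt hBw]; exact hu
  have hnn : 0 ≤ c * (Real.sqrt Bz * Real.sqrt Bw) := by positivity
  have hu' : ‖u‖ ≤ c * (Real.sqrt Bz * Real.sqrt Bw) := by
    have := Real.sqrt_le_sqrt hsq
    rwa [Real.sqrt_sq (norm_nonneg u), Real.sqrt_sq hnn] at this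
  have hzw : 0 ≤ ‖z‖ * ‖w‖ := by positivity
  nlinarith [mul_le_mul_of_nonneg_left hu' hzw, Real.sqrt_nonneg Bz, Real.sqrt_nonneg Bw]

variable {X₁ Y₁ X₂ : PairFunctional} {f f' g₁ g₁' g₂ g₂' : ℝ → ℂ} {𝒞 : PairClass}

/-- **Mixed scaled Gershgorin (proved, (A)-free):** at a design with diagonal forms `≥ 0`, cells `‖X₁‖², ‖Y₁‖² ≤ c₁²·𝔅𝔅` and
`‖X₂‖² ≤ c₂²·𝔅𝔅` with `0 ≤ c₁`, `0 ≤ c₂ ≤ 1 − 2c₁²`, the graded form is non-negative at every amplitude vector.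
[cite: Zhang2022LandauSiegel, §2 (2.16)–(2.17)] -/
theorem gradedQuadForm_nonneg_of_cells_le_mixed {c₁ c₂ : ℝ} (hc₁ : 0 ≤ c₁) (hc₂ : 0 ≤ c₂) (hmix : c₂ ≤ 1 - 2 * c₁ ^ 2)
    (hB0 : 0 ≤ mainTermForm f f') (hB1 : 0 ≤ mainTermForm g₁ g₁') (hB2 : 0 ≤ mainTermForm g₂ g₂')
    (h01 : ‖X₁ f f' g₁ g₁'‖ ^ 2 ≤ c₁ ^ 2 * (mainTermForm f f' * mainTermForm g₁ g₁'))
    (h12 : ‖Y₁ g₁ g₁' g₂ g₂'‖ ^ 2 ≤ c₁ ^ 2 * (mainTermForm g₁ g₁' * mainTermForm g₂ g₂'))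
    (h02 : ‖X₂ f f' g₂ g₂'‖ ^ 2 ≤ c₂ ^ 2 * (mainTermForm f f' * mainTermForm g₂ g₂')) (s : Fin 3 → ℂ) :
    0 ≤ gradedQuadForm (gradedMainMatrix X₁ Y₁ X₂ f f' g₁ g₁' g₂ g₂') s := by
  rw [gradedQuadForm_eq]
  set a₀ := Real.sqrt (mainTermForm f f') * ‖s 0‖ with ha₀
  set a₁ := Real.sqrt (mainTermForm g₁ g₁') * ‖s 1‖ with ha₁
  set a₂ := Real.sqrt (mainTermForm g₂ g₂') * ‖s 2‖ with ha₂
  have e₀ : mainTermForm f f' * ‖s 0‖ ^ 2 = a₀ ^ 2 := by rw [ha₀, mul_pow, Real.sq_sqrt hB0]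
  have e₁ : mainTermForm g₁ g₁' * ‖s 1‖ ^ 2 = a₁ ^ 2 := by rw [ha₁, mul_pow, Real.sq_sqrt hB1]
  have e₂ : mainTermForm g₂ g₂' * ‖s 2‖ ^ 2 = a₂ ^ 2 := by rw [ha₂, mul_pow, Real.sq_sqrt hB2]
  have k01 := two_re_cross_ge_const (s 0) (s 1) (X₁ f f' g₁ g₁') hB0 hB1 hc₁ h01
  have k12 := two_re_cross_ge_const (s 1) (s 2) (Y₁ g₁ g₁' g₂ g₂') hB1 hB2 hc₁ h12
  have k02 := two_re_cross_ge_const (s 0) (s 2) (X₂ f f' g₂ g₂') hB0 hB2 hc₂ h02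
  have core := mixed_real_form_nonneg (a₁ := a₁) hc₂ hmix (by positivity : 0 ≤ a₀) (by positivity : 0 ≤ a₂)
  rw [e₀, e₁, e₂]
  rw [← ha₀, ← ha₁] at k01
  rw [← ha₁, ← ha₂] at k12
  rw [← ha₀, ← ha₂] at k02
  linarith

/-! ### Part 2 — below the parabola: no closing ON the class -/

/-- **TWO-CONSTANT WRAP BOUND ⇒ NO CLOSING ON THE CLASS (proved, (A)-free):** if on every in-class pair of `𝒞` the degree-1 tables
satisfy `‖X₁(u,v)‖², ‖Y₁(u,v)‖² ≤ c₁²·𝔅(u)𝔅(v)` and the degree-2 table `‖X₂(u,v)‖² ≤ c₂²·𝔅(u)𝔅(v)`, with `0 ≤ c₁`, `0 ≤ c₂` and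
**`c₂ ≤ 1 − 2c₁²`**, then `¬ GradedClosesOn 𝒞 X₁ Y₁ X₂`. Special points: `c₁ = c₂ = ½` is `not_gradedClosesOn_of_cells_le_half_geom`;
`c₁ = 0, c₂ = 1` is the 2×2-minor wall. [cite: Zhang2022LandauSiegel, §2 (2.16)–(2.17), §7 Prop 7.1 (7.2)] -/
theorem not_gradedClosesOn_of_cells_le_mixed {c₁ c₂ : ℝ} (hc₁ : 0 ≤ c₁) (hc₂ : 0 ≤ c₂) (hmix : c₂ ≤ 1 - 2 * c₁ ^ 2)
    (hX₁ : ∀ u u' v v', InClassPiece u u' → InClassPiece v v' → 𝒞 u u' v v' →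
      ‖X₁ u u' v v'‖ ^ 2 ≤ c₁ ^ 2 * (mainTermForm u u' * mainTermForm v v'))
    (hY₁ : ∀ u u' v v', InClassPiece u u' → InClassPiece v v' → 𝒞 u u' v v' →
      ‖Y₁ u u' v v'‖ ^ 2 ≤ c₁ ^ 2 * (mainTermForm u u' * mainTermForm v v'))
    (hX₂ : ∀ u u' v v', InClassPiece u u' → InClassPiece v v' → 𝒞 u u' v v' →
      ‖X₂ u u' v v'‖ ^ 2 ≤ c₂ ^ 2 * (mainTermForm u u' * mainTermForm v v')) :
    ¬ GradedClosesOn 𝒞 X₁ Y₁ X₂ := by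
  rintro ⟨f, f', g₁, g₁', g₂, g₂', s, hf, hg₁, hg₂, h01, h02, h12, hneg⟩
  have hB0 := mainTermForm_nonneg_of_isH1 hf.kinked.isH1
  have hB1 := mainTermForm_nonneg_of_isH1 hg₁.kinked.isH1
  have hB2 := mainTermForm_nonneg_of_isH1 hg₂.kinked.isH1
  have := gradedQuadForm_nonneg_of_cells_le_mixed hc₁ hc₂ hmix hB0 hB1 hB2 (hX₁ _ _ _ _ hf hg₁ h01)
    (hY₁ _ _ _ _ hg₁ hg₂ h12) (hX₂ _ _ _ _ hf hg₂ h02) s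
  linarith

/-! ### Part 3 — above the parabola: the aligned design closes (sharpness along the whole curve) -/

section MixedTriple

variable {B t₁ t₂ c₁ c₂ : ℝ}

/-- `Re(1·conj(m·(−t))) = −mt` for real `m, t`. [folklore] -/
theorem re_one_mul_conj_real_mul_neg (m t : ℝ) : ((1 : ℂ) * conj ((m : ℂ) * -(t : ℂ))).re = -(m * t) := by
  have h : (m : ℂ) * -(t : ℂ) = ((-(m * t) : ℝ) : ℂ) := by push_cast; ring
  rw [h, Complex.conj_ofReal, one_mul, Complex.ofReal_re]

/-- `Re(m·conj(1·(−t))) = −mt` for real `m, t`. [folklore] -/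
theorem re_real_mul_conj_one_mul_neg (m t : ℝ) : ((m : ℂ) * conj ((1 : ℂ) * -(t : ℂ))).re = -(m * t) := by
  have h : (1 : ℂ) * -(t : ℂ) = ((-t : ℝ) : ℂ) := by push_cast; ring
  rw [h, Complex.conj_ofReal]
  have h' : (m : ℂ) * (((-t : ℝ)) : ℂ) = ((-(m * t) : ℝ) : ℂ) := by push_cast; ring
  rw [h', Complex.ofReal_re]

/-- `Re(1·conj(1·(−t))) = −t` for real `t`. [folklore] -/
theorem re_one_mul_conj_one_mul_neg (t : ℝ) : ((1 : ℂ) * conj ((1 : ℂ) * -(t : ℂ))).re = -t := by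
  rw [one_mul, one_mul, map_neg, Complex.conj_ofReal, Complex.neg_re, Complex.ofReal_re]

/-- **The aligned triple at amplitudes `(1, m, 1)` (pure algebra):** with `𝔅(f) = 𝔅(g₁) = 𝔅(g₂) = B` and real aligned cells
`X₁(f,g₁) = Y₁(g₁,g₂) = −t₁`, `X₂(f,g₂) = −t₂`, the graded form at `s = (1, m, 1)` (`m` real) equals `2B + Bm² − 4mt₁ − 2t₂`.
[cite: Zhang2022LandauSiegel, §2 (2.16)–(2.17)] -/
theorem mixedTriple_gradedQuadForm (m : ℝ) (hBf : mainTermForm f f' = B) (hB1 : mainTermForm g₁ g₁' = B)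
    (hB2 : mainTermForm g₂ g₂' = B) (hX₁ : X₁ f f' g₁ g₁' = -(t₁ : ℂ)) (hY₁ : Y₁ g₁ g₁' g₂ g₂' = -(t₁ : ℂ))
    (hX₂ : X₂ f f' g₂ g₂' = -(t₂ : ℂ)) :
    gradedQuadForm (gradedMainMatrix X₁ Y₁ X₂ f f' g₁ g₁' g₂ g₂') ![1, (m : ℂ), 1]
      = 2 * B + B * m ^ 2 - 4 * m * t₁ - 2 * t₂ := by
  rw [gradedQuadForm_eq, hBf, hB1, hB2, hX₁, hY₁, hX₂]
  have hn : ‖(m : ℂ)‖ ^ 2 = m ^ 2 := by rw [Complex.norm_real, Real.norm_eq_abs, sq_abs]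
  simp only [Matrix.cons_val_zero, Matrix.cons_val_one, Matrix.head_cons, Matrix.cons_val_two, Matrix.tail_cons,
    norm_one, one_pow, mul_one, hn]
  rw [re_one_mul_conj_real_mul_neg, re_real_mul_conj_one_mul_neg, re_one_mul_conj_one_mul_neg]
  ring

/-- **ABOVE THE PARABOLA THE ALIGNED DESIGN CLOSES ON THE CLASS (proved): sharpness of `c₂ ≤ 1 − 2c₁²`.** In-class pieces with
the three pairs in `𝒞`, equal side tables `B > 0`, aligned real cells `X₁ = Y₁ = −c₁B`, `X₂ = −c₂B` and `1 − 2c₁² < c₂` give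
`GradedClosesOn 𝒞 X₁ Y₁ X₂`, witnessed at the amplitudes `(1, 2c₁, 1)` where the form is `2B(1 − 2c₁² − c₂) < 0`. At `c₁ = c₂`
this is the coherent triple of `DetClosesOn` (threshold `½`); at `c₁ = 0` it is the 2×2-minor wall `c₂ = 1`.
[cite: Zhang2022LandauSiegel, §2 (2.16)–(2.17), §7 Prop 7.1 (7.2)] -/
theorem gradedClosesOn_mixedTriple (hf : InClassPiece f f') (hg₁ : InClassPiece g₁ g₁') (hg₂ : InClassPiece g₂ g₂')
    (h01 : 𝒞 f f' g₁ g₁') (h02 : 𝒞 f f' g₂ g₂') (h12 : 𝒞 g₁ g₁' g₂ g₂')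
    (hBf : mainTermForm f f' = B) (hB1 : mainTermForm g₁ g₁' = B) (hB2 : mainTermForm g₂ g₂' = B)
    (hX₁ : X₁ f f' g₁ g₁' = -((c₁ * B : ℝ) : ℂ)) (hY₁ : Y₁ g₁ g₁' g₂ g₂' = -((c₁ * B : ℝ) : ℂ))
    (hX₂ : X₂ f f' g₂ g₂' = -((c₂ * B : ℝ) : ℂ)) (hB : 0 < B) (habove : 1 - 2 * c₁ ^ 2 < c₂) :
    GradedClosesOn 𝒞 X₁ Y₁ X₂ :=
  ⟨f, f', g₁, g₁', g₂, g₂', ![1, ((2 * c₁ : ℝ) : ℂ), 1], hf, hg₁, hg₂, h01, h02, h12, by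
    rw [mixedTriple_gradedQuadForm (2 * c₁) hBf hB1 hB2 hX₁ hY₁ hX₂]
    nlinarith [mul_pos hB (sub_pos.mpr habove)]⟩

/-- **The two readings agree on the curve (pure algebra):** the aligned design sits exactly ON the hypotheses of
`not_gradedClosesOn_of_cells_le_mixed` — `‖−cB‖² = c²·B·B`. [folklore] -/
theorem norm_sq_alignedCell (c : ℝ) (B : ℝ) : ‖-((c * B : ℝ) : ℂ)‖ ^ 2 = c ^ 2 * (B * B) := by
  rw [norm_neg, Complex.norm_real, Real.norm_eq_abs, sq_abs]; ring

end MixedTriple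

end Summit.Parity.GeneralizedHardyLittlewood.Theorems.PsiGradedTablesClosePoly.Negative

end
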